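import Summits.NavierStokesRegularity.NavierStokesRegularity.Theorems.WakeRatchetEternalInviscidRateConveyorFlux

/-!
# Conveyor ledger (crux `WakeRatchet.EternalInviscidRate`, ⟨stmt-NavierStokesRegularity-25646⟩) —
# WAKE FROM PEAK: every shell strands at least `e^{−cA}·(peak − later backscatter)`; ONE-WAY solutions have NO CONVEYOR

Helpers for the open stub `stub_noConveyor` of the registered skeleton «conveyor ledger» (LINE g10-3, sha16 d183ebc25b56, namespace
`…Cruxes.EternalInviscidRate.FinalWakeLedger`).  MODEL lattice only (Tao 2016 §4 renormalised cascade); nothing here is a statement about the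
Navier–Stokes equations, no stub is closed by name, no summit is proved by this file.

THE LEAK INEQUALITY.  For an admissible INVISCID eternal solution of a cancelling table the shell energy obeys `E_n' = F_{n−1} − F_n` with
`|F_n| ≤ 2C_AΛ⁻¹‖W_{n+1}‖·E_n` (landed `hasDerivAt_physEnergy`, `abs_physFlux_le`): energy leaves shell `n` UPWARD at relative rate at most
`a(σ) = 2C_AΛ⁻¹‖W_{n+1}(σ)‖`, whose total `∫_ℝ a ≤ 2C_AΛ⁻¹·A =: cA` is finite by the ACTION clause (`∫‖W_{n+1}‖ ≤ A`).  Hence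
* `physEnergy_leak_lower` — `E_n(σ) ≥ e^{−cA}·E_n(σ₀) − ∫_{σ₀}^{σ} F⁻_{n−1}` for `σ ≥ σ₀` (`F⁻ = max(−F,0)` the backscatter returned to
  shell `n−1`): integrating factor `e^{∫a}` on `E_n e^{∫a} + e^{cA}∫F⁻`, which is non-decreasing.
* `finalWake_ge_peak_sub_backscatter` — letting `σ → ∞`: the FINAL WAKE of shell `n` is at least `e^{−cA}·E_n(σ₀) − ∫_{σ₀}^{∞} F⁻_{n−1}` for
  every `σ₀`: a shell strands at least the fraction `e^{−cA}` of any energy level it reaches, up to the backscatter it later returns downward.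
  So g0's residual of `stub_noConveyor` (PeaksFade, `noConveyor_of_peaks_fade`) can fail ONLY along shells whose peaks are returned DOWNWARD
  almost entirely (`∫_{σ₀}^{∞}F⁻_{n−1} ≥ e^{−cA}E_n(σ₀) − o(1)`): a conveyor needs persistent, nearly total backscatter at every high shell.
* `finalWake_ge_exp_neg_mul_physEnergy_oneway` — ONE-WAY solutions (all bond fluxes `≥ 0`, e.g. the dyadic member with non-negative data):
  `ω_n ≥ e^{−cA}·sup_σ E_n(σ)` — a per-shell WAKE FLOOR relative to the peak.
* `peaksFade_oneway`, `noConveyor_oneway` — hence peaks fade (`ω_n → 0`, wakes being summable) and, by the landed `noConveyor_of_peaks_fade`,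
  the inner conclusion of `NoConveyor` holds for EVERY uniformly bounded admissible inviscid ONE-WAY eternal solution of every cancelling table
  (any `ε₀ > 0`): `stub_noConveyor` is SETTLED on the one-way stratum (companion of `…NoUnitaryFront`: settled on the block-self-similar stratum).
[cite: Tao2016AveragedNS, §4 Lemma 4.1 (4.8)–(4.10) with the cancellation (4.3), in the self-similar variables of §6.4]
-/

noncomputable section

set_option linter.dupNamespace false

open Filter Topology Set MeasureTheory
open Literature.Analysis.FluidPDE Literature.Analysis.FluidPDE.TaoCascade
open Summit.NavierStokesRegularity.NavierStokesRegularity.Theorems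

namespace Summit.NavierStokesRegularity.NavierStokesRegularity.Cruxes.EternalInviscidRate.FinalWakeLedger

variable {ε₀ : ℝ}

/-! ## The leak inequality -/

section Leak

variable {m : ℕ} {α : Fin m → Fin m → Fin m → ℤ × ℤ × ℤ → ℝ} {W : ℤ → ℝ → Em m}

/-- `F_k` is continuous along an admissible eternal solution of a cancelling table. -/
theorem continuous_physFlux_of_isEternal (hc : IsCancellingCoeff α) (hW : IsEternal ε₀ α W) (k : ℤ) :
    Continuous (physFlux ε₀ α W k) := by
  have h1 : Continuous (W (k + 1)) := continuous_iff_continuousAt.2 fun σ => (hW.law (k + 1) σ).continuousAt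
  have h0 : Continuous (W k) := continuous_iff_continuousAt.2 fun σ => (hW.law k σ).continuousAt
  have h2 : Continuous fun σ => tableA α (W k σ) := (table_sTable α hc).contA.comp h0
  unfold physFlux
  exact continuous_const.mul ((by fun_prop : Continuous fun σ : ℝ => Real.exp (2 * σ)).mul (h1.inner h2))

/-- **THE LEAK INEQUALITY.**  For an admissible inviscid eternal solution of a cancelling table (`ε₀ > 0`) with `∫_ℝ ‖W_{n+1}‖ ≤ A`, and
`σ₀ ≤ σ`:  `e^{−2C_AΛ⁻¹A}·E_n(σ₀) − ∫_{σ₀}^{σ} max(−F_{n−1}, 0) ≤ E_n(σ)` — shell `n` keeps at least the fraction `e^{−2C_AΛ⁻¹A}` of its energy,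
up to the backscatter it returns to shell `n−1`.  MODEL lattice only.
[cite: Tao2016AveragedNS, §4 Lemma 4.1 (4.8)–(4.10) with the cancellation (4.3), §6.4] -/
theorem physEnergy_leak_lower (hε : 0 < ε₀) (hc : IsCancellingCoeff α) (hW : IsEternal ε₀ α W) (n : ℤ)
    {A : ℝ} (hint : Integrable (fun σ => ‖W (n + 1) σ‖)) (hA : ∫ σ, ‖W (n + 1) σ‖ ≤ A)
    {σ₀ σ : ℝ} (hσ : σ₀ ≤ σ) :
    Real.exp (-(2 * fluxConst α * (bigLam ε₀)⁻¹ * A)) * physEnergy ε₀ W n σ₀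
        - ∫ s in σ₀..σ, max (-physFlux ε₀ α W (n - 1) s) 0 ≤ physEnergy ε₀ W n σ := by
  have hΛ : 0 < bigLam ε₀ := bigLam_pos (by linarith)
  set c : ℝ := 2 * fluxConst α * (bigLam ε₀)⁻¹ with hc_def
  have hc0 : 0 ≤ c := by have := fluxConst_nonneg α; rw [hc_def]; positivity
  -- the leak rate
  set a : ℝ → ℝ := fun s => c * ‖W (n + 1) s‖ with ha
  have ha0 : ∀ s, 0 ≤ a s := fun s => mul_nonneg hc0 (norm_nonneg _)
  have hcontW : Continuous (fun s : ℝ => ‖W (n + 1) s‖) :=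
    (continuous_iff_continuousAt.2 fun s => (hW.law (n + 1) s).continuousAt).norm
  have hcont_a : Continuous a := continuous_const.mul hcontW
  have hint_a : Integrable a := hint.const_mul c
  -- the energy, its derivative, the flux bound
  set E : ℝ → ℝ := physEnergy ε₀ W n with hE
  have hE0 : ∀ s, 0 ≤ E s := fun s => physEnergy_nonneg _ _ _ _
  have hEd : ∀ s, HasDerivAt E (physFlux ε₀ α W (n - 1) s - physFlux ε₀ α W n s) s := by
    intro s
    have h := hasDerivAt_physEnergy hε hW.isEternalVisc hc n s
    refine h.congr_deriv ?_
    simp [viscCoef]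
  have hFn : ∀ s, |physFlux ε₀ α W n s| ≤ a s * E s := by
    intro s
    have h := abs_physFlux_le hε hc W n s
    calc |physFlux ε₀ α W n s| ≤ 2 * fluxConst α * (bigLam ε₀)⁻¹ * ‖W (n + 1) s‖ * physEnergy ε₀ W n s := h
      _ = a s * E s := by rw [ha, hE]
  -- the backscatter density and its primitive
  set Fm : ℝ → ℝ := fun s => max (-physFlux ε₀ α W (n - 1) s) 0 with hFm
  have hFm0 : ∀ s, 0 ≤ Fm s := fun s => le_max_right _ _
  have hcont_Fm : Continuous Fm := ((continuous_physFlux_of_isEternal hc hW (n - 1)).neg).max continuous_const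
  have hFge : ∀ s, -Fm s ≤ physFlux ε₀ α W (n - 1) s := fun s => neg_le.1 (le_max_left _ _)
  set Φ : ℝ → ℝ := fun s => ∫ u in σ₀..s, Fm u with hΦ
  have hΦd : ∀ s, HasDerivAt Φ (Fm s) s := fun s => (hcont_Fm.integral_hasStrictDerivAt σ₀ s).hasDerivAt
  -- the integrating factor, bounded by `e^{cA}` everywhere
  set I : ℝ → ℝ := fun s => ∫ u in σ₀..s, a u with hI
  have hId : ∀ s, HasDerivAt I (a s) s := fun s => (hcont_a.integral_hasStrictDerivAt σ₀ s).hasDerivAt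
  have hIle : ∀ s, I s ≤ c * A := by
    intro s
    have htot : ∫ u, a u ≤ c * A := by
      calc ∫ u, a u = c * ∫ u, ‖W (n + 1) u‖ := integral_const_mul _ _
        _ ≤ c * A := mul_le_mul_of_nonneg_left hA hc0
    rcases le_total σ₀ s with h | h
    · simp only [hI]
      rw [intervalIntegral.integral_of_le h]
      exact (setIntegral_le_integral hint_a (Eventually.of_forall ha0)).trans htot
    · simp only [hI]
      rw [intervalIntegral.integral_symm, intervalIntegral.integral_of_le h]
      have h1 : 0 ≤ ∫ u in Ioc s σ₀, a u := setIntegral_nonneg measurableSet_Ioc fun u _ => ha0 u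
      have h2 : 0 ≤ c * A := le_trans (integral_nonneg ha0) htot
      linarith
  -- the monotone functional `G = E e^{I} + e^{cA} Φ`
  set G : ℝ → ℝ := fun s => E s * Real.exp (I s) + Real.exp (c * A) * Φ s with hG
  have hGd : ∀ s, HasDerivAt G
      ((physFlux ε₀ α W (n - 1) s - physFlux ε₀ α W n s) * Real.exp (I s) + E s * (Real.exp (I s) * a s)
        + Real.exp (c * A) * Fm s) s :=
    fun s => ((hEd s).mul (hId s).exp).add ((hΦd s).const_mul _)
  have hG' : ∀ s, 0 ≤ deriv G s := by
    intro s
    rw [(hGd s).deriv]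
    have hexp : 0 < Real.exp (I s) := Real.exp_pos _
    have hexp' : Real.exp (I s) ≤ Real.exp (c * A) := Real.exp_le_exp.2 (hIle s)
    have h1 : -(a s * E s) ≤ -physFlux ε₀ α W n s := by
      have := le_abs_self (physFlux ε₀ α W n s); linarith [hFn s]
    -- `(F_{n-1} - F_n + aE) e^{I} ≥ -Fm e^{I} ≥ -Fm e^{cA}`
    have h2 : -Fm s * Real.exp (I s) ≤
        (physFlux ε₀ α W (n - 1) s - physFlux ε₀ α W n s) * Real.exp (I s) + E s * (Real.exp (I s) * a s) := by
      have h3 : -Fm s ≤ physFlux ε₀ α W (n - 1) s - physFlux ε₀ α W n s + E s * a s := by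
        linarith [hFge s]
      have := mul_le_mul_of_nonneg_right h3 hexp.le
      linarith [this]
    have h4 : Fm s * Real.exp (I s) ≤ Real.exp (c * A) * Fm s := by
      rw [mul_comm]; exact mul_le_mul_of_nonneg_right hexp' (hFm0 s)
    linarith
  have hGmono : Monotone G := monotone_of_deriv_nonneg (fun s => (hGd s).differentiableAt) hG'
  -- compare `G σ₀ = E σ₀` with `G σ`
  have hG0 : G σ₀ = E σ₀ := by
    simp [hG, hI, hΦ, intervalIntegral.integral_same]
  have hmono := hGmono hσ
  rw [hG0] at hmono
  -- `E σ ≥ E σ e^{I σ} e^{-cA} ≥ (E σ₀ - e^{cA} Φ σ) e^{-cA} = e^{-cA} E σ₀ - Φ σ`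
  have hfac : Real.exp (I σ) * Real.exp (-(c * A)) ≤ 1 := by
    rw [← Real.exp_add]; exact Real.exp_le_one_iff.2 (by linarith [hIle σ])
  have hecA : Real.exp (c * A) * Real.exp (-(c * A)) = 1 := by
    rw [← Real.exp_add, add_neg_cancel, Real.exp_zero]
  have h5 : E σ * (Real.exp (I σ) * Real.exp (-(c * A))) ≤ E σ * 1 := mul_le_mul_of_nonneg_left hfac (hE0 σ)
  have h6 : (E σ * Real.exp (I σ) + Real.exp (c * A) * Φ σ) * Real.exp (-(c * A)) ≥ E σ₀ * Real.exp (-(c * A)) :=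
    mul_le_mul_of_nonneg_right hmono (Real.exp_pos _).le
  have h7 : (E σ * Real.exp (I σ) + Real.exp (c * A) * Φ σ) * Real.exp (-(c * A))
      = E σ * (Real.exp (I σ) * Real.exp (-(c * A))) + Φ σ * (Real.exp (c * A) * Real.exp (-(c * A))) := by ring
  rw [h7, hecA, mul_one] at h6
  show Real.exp (-(c * A)) * E σ₀ - Φ σ ≤ E σ
  linarith

end Leak

/-! ## Final wakes from peaks -/

variable {α : Fin 4 → Fin 4 → Fin 4 → ℤ × ℤ × ℤ → ℝ} {W : ℤ → ℝ → Em 4}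

/-- **The final wake of a shell is at least `e^{−cA}·(any level it reaches) − (the backscatter it later returns).**  For a uniformly
bounded admissible inviscid eternal solution of a cancelling table with final tails, `∫_ℝ‖W_{n+1}‖ ≤ A` and final wake
`ω_n = lim_σ E_n(σ)`:  `e^{−2C_AΛ⁻¹A}·E_n(σ₀) − ∫_{(σ₀,∞)} max(−F_{n−1},0) ≤ ω_n` for every `σ₀`.  MODEL lattice only.
[cite: Tao2016AveragedNS, §4 Lemma 4.1 (4.8)–(4.10) with the cancellation (4.3), §6.4] -/
theorem finalWake_ge_peak_sub_backscatter (hε : 0 < ε₀) (hc : IsCancellingCoeff α) (hW : IsEternal ε₀ α W)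
    (hU : UniformBound W) (n : ℤ) {A : ℝ} (hA : ∫ σ, ‖W (n + 1) σ‖ ≤ A)
    {L : ℤ → ℝ} (hL : ∀ n : ℤ, Tendsto (fun σ => ∑' k : ℕ, physEnergy ε₀ W (n + k) σ) atTop (𝓝 (L n)))
    {ωn : ℝ} (hω : Tendsto (physEnergy ε₀ W n) atTop (𝓝 ωn)) (σ₀ : ℝ) :
    Real.exp (-(2 * fluxConst α * (bigLam ε₀)⁻¹ * A)) * physEnergy ε₀ W n σ₀
        - ∫ s in Ioi σ₀, max (-physFlux ε₀ α W (n - 1) s) 0 ≤ ωn := by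
  obtain ⟨M, hM⟩ := hW.action
  obtain ⟨S, -, hS⟩ := exists_peak_bound hε hU (n - 1) (hL (n - 1))
  have hFint : Integrable (fun s => max (-physFlux ε₀ α W (n - 1) s) 0) :=
    (integrable_physFlux hε hc hW hU (n - 1) hS).neg_part
  have hlim : Tendsto (fun σ => Real.exp (-(2 * fluxConst α * (bigLam ε₀)⁻¹ * A)) * physEnergy ε₀ W n σ₀
      - ∫ s in σ₀..σ, max (-physFlux ε₀ α W (n - 1) s) 0) atTop
      (𝓝 (Real.exp (-(2 * fluxConst α * (bigLam ε₀)⁻¹ * A)) * physEnergy ε₀ W n σ₀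
        - ∫ s in Ioi σ₀, max (-physFlux ε₀ α W (n - 1) s) 0)) :=
    tendsto_const_nhds.sub (intervalIntegral_tendsto_integral_Ioi σ₀ hFint.integrableOn tendsto_id)
  refine le_of_tendsto_of_tendsto hlim hω ?_
  filter_upwards [eventually_ge_atTop σ₀] with σ hσ
  exact physEnergy_leak_lower hε hc hW n (hM (n + 1)).1 hA hσ

/-! ## One-way solutions: wake floor from the peak, fading peaks, no conveyor -/

/-- **One-way wake floor.**  If every bond flux is non-negative (one-way dynamics), the final wake of shell `n` is at least `e^{−2C_AΛ⁻¹A}`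
times ANY energy level the shell reaches: `e^{−2C_AΛ⁻¹A}·E_n(σ₀) ≤ ω_n` (`∫_ℝ‖W_{n+1}‖ ≤ A`).  MODEL lattice only.
[cite: Tao2016AveragedNS, §4 Lemma 4.1 (4.8)–(4.10) with the cancellation (4.3), §6.4] -/
theorem finalWake_ge_exp_neg_mul_physEnergy_oneway (hε : 0 < ε₀) (hc : IsCancellingCoeff α) (hW : IsEternal ε₀ α W)
    (hpos : ∀ (k : ℤ) (σ : ℝ), 0 ≤ physFlux ε₀ α W k σ) (n : ℤ) {A : ℝ} (hA : ∫ σ, ‖W (n + 1) σ‖ ≤ A)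
    {ωn : ℝ} (hω : Tendsto (physEnergy ε₀ W n) atTop (𝓝 ωn)) (σ₀ : ℝ) :
    Real.exp (-(2 * fluxConst α * (bigLam ε₀)⁻¹ * A)) * physEnergy ε₀ W n σ₀ ≤ ωn := by
  obtain ⟨M, hM⟩ := hW.action
  have hzero : (fun s => max (-physFlux ε₀ α W (n - 1) s) 0) = fun _ => 0 := by
    funext s; exact max_eq_right (by linarith [hpos (n - 1) s])
  have hlim : Tendsto (fun σ => Real.exp (-(2 * fluxConst α * (bigLam ε₀)⁻¹ * A)) * physEnergy ε₀ W n σ₀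
      - ∫ s in σ₀..σ, max (-physFlux ε₀ α W (n - 1) s) 0) atTop
      (𝓝 (Real.exp (-(2 * fluxConst α * (bigLam ε₀)⁻¹ * A)) * physEnergy ε₀ W n σ₀)) := by
    rw [hzero]
    simp only [intervalIntegral.integral_zero, sub_zero]
    exact tendsto_const_nhds
  refine le_of_tendsto_of_tendsto hlim hω ?_
  filter_upwards [eventually_ge_atTop σ₀] with σ hσ
  exact physEnergy_leak_lower hε hc hW n (hM (n + 1)).1 hA hσ

/-- **One-way solutions: peaks fade along the shells.**  For a uniformly bounded admissible inviscid ONE-WAY eternal solution of a cancelling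
table with final wakes and final tails, for every `δ > 0` some shell's physical energy stays `≤ δ` at all log-times (wakes are summable,
hence tend to `0`, and each bounds `e^{−cM}` times its shell's peak).  MODEL lattice only.
[cite: Tao2016AveragedNS, §4 Lemma 4.1 (4.8)–(4.10) with the cancellation (4.3), §6.4] -/
theorem peaksFade_oneway (hε : 0 < ε₀) (hc : IsCancellingCoeff α) (hW : IsEternal ε₀ α W) (hU : UniformBound W)
    (hpos : ∀ (k : ℤ) (σ : ℝ), 0 ≤ physFlux ε₀ α W k σ)
    {ω : ℤ → ℝ} (hω : ∀ k : ℤ, Tendsto (physEnergy ε₀ W k) atTop (𝓝 (ω k)))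
    {L : ℤ → ℝ} (hL : ∀ n : ℤ, Tendsto (fun σ => ∑' k : ℕ, physEnergy ε₀ W (n + k) σ) atTop (𝓝 (L n)))
    {δ : ℝ} (hδ : 0 < δ) : ∃ n : ℤ, ∀ σ : ℝ, physEnergy ε₀ W n σ ≤ δ := by
  obtain ⟨M, hM⟩ := hW.action
  have hS : ∀ (n : ℤ) (σ : ℝ), Summable (fun k : ℕ => physEnergy ε₀ W (n + k) σ) :=
    summable_physEnergy_tail_cm hε hU
  set q : ℝ := Real.exp (-(2 * fluxConst α * (bigLam ε₀)⁻¹ * M)) with hq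
  have hq0 : 0 < q := Real.exp_pos _
  -- wakes above shell `0` are summable, hence tend to zero
  have hwk : Tendsto (fun k : ℕ => ω (0 + k)) atTop (𝓝 0) := (finalWake_summable hS hω hL 0).tendsto_atTop_zero
  obtain ⟨k, hk⟩ : ∃ k : ℕ, ω (0 + k) < q * δ :=
    ((tendsto_order.1 hwk).2 (q * δ) (mul_pos hq0 hδ)).exists
  refine ⟨0 + k, fun σ => ?_⟩
  have h := finalWake_ge_exp_neg_mul_physEnergy_oneway hε hc hW hpos (0 + k) (hM (0 + k + 1)).2 (hω (0 + k)) σ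
  -- `q · E ≤ ω < q · δ`
  by_contra hlt
  push Not at hlt
  have : q * δ < q * physEnergy ε₀ W (0 + k) σ := mul_lt_mul_of_pos_left hlt hq0
  linarith

/-- **`stub_noConveyor` on the ONE-WAY stratum.**  Every uniformly bounded admissible inviscid eternal solution of a cancelling table
(`m = 4`, any `ε₀ > 0`) whose bond fluxes are all non-negative has no conveyor mass: every final tail is the sum of the final wakes above it
(the inner conclusion of `NoConveyor`).  MODEL lattice only.
[cite: Tao2016AveragedNS, §4 Lemma 4.1 (4.8)–(4.10) with the cancellation (4.3), §6.4] -/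
theorem noConveyor_oneway (hε : 0 < ε₀) (hc : IsCancellingCoeff α) (hW : IsEternal ε₀ α W) (hU : UniformBound W)
    (hpos : ∀ (k : ℤ) (σ : ℝ), 0 ≤ physFlux ε₀ α W k σ)
    {ω : ℤ → ℝ} (hω : ∀ k : ℤ, Tendsto (physEnergy ε₀ W k) atTop (𝓝 (ω k)))
    {L : ℤ → ℝ} (hL : ∀ n : ℤ, Tendsto (fun σ => ∑' k : ℕ, physEnergy ε₀ W (n + k) σ) atTop (𝓝 (L n)))
    (n : ℤ) : L n = ∑' k : ℕ, ω (n + k) :=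
  noConveyor_of_peaks_fade hε hc hW hU hω hL (fun _ hδ => peaksFade_oneway hε hc hW hU hpos hω hL hδ) n

end Summit.NavierStokesRegularity.NavierStokesRegularity.Cruxes.EternalInviscidRate.FinalWakeLedger

end
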